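import Mathlib
import Summits.Ventures.PercRepro2.SwOutAll
import Summits.Ventures.PercRepro2.SwOutArmFlip
import Summits.Ventures.PercRepro2.SwOutJunctionSplit
import Summits.Ventures.PercRepro2.SwOutJunctionFine

/-!
# The class and the side `Q` through the split (blind cell PercRepro2, night-4 g11, 2026-08-25;
proofs/NIGHT4-G11.md §2)

The split region `splitRegion U` (the copies of `U` together with all copies of `u`); the outside
class passes to the split and comes back on split-fine configurations
(`mem_outClass_split_of_mem`, `mem_outClass_of_mem_split`); the side `Q` passes to the split and
comes back on split-fine configurations (`mem_tgtU_split_of_mem`, `mem_tgtU_of_mem_split`) — the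
junction is never in a cluster of `l` there (`u_notMem_cluster_l_of_splitFine`).
-/

namespace Summit.Ventures.PercRepro2

namespace LocRows

open Hull

variable {V : Type*} {E : Type*} [Fintype E] [DecidableEq E]

open scoped Classical

/-! ## The region, the class and the side `Q` through the split -/

section Region

variable {ends : E → Sym2 V} {u : V}

/-- The split region: the copies of the region's vertices together with all copies of `u`. -/
def splitRegion (U : Set V) : Set (V ⊕ E) := Sum.inl '' U ∪ Set.range Sum.inr

omit [Fintype E] [DecidableEq E] in
/-- An edge touches the split region iff it touches the region (`u ∈ U`). -/
lemma mem_touches_split_iff {U : Set V} (hu : u ∈ U) {e : E} :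
    e ∈ touches (splitEnds ends u) (splitRegion U) ↔ e ∈ touches ends U := by
  constructor
  · rintro ⟨x', hx', y', hxy⟩
    by_cases he : u ∈ ends e
    · exact ⟨u, hu, Sym2.Mem.other he, ends_eq_other he⟩
    · rw [splitEnds_of_notMem he] at hxy
      have hx'mem : x' ∈ (ends e).map Sum.inl := by rw [hxy]; exact Sym2.mem_mk_left _ _
      rw [Sym2.mem_map] at hx'mem
      obtain ⟨x, hx, rfl⟩ := hx'mem
      rcases hx' with ⟨x₁, hx₁, hx₁'⟩ | ⟨e₁, he₁⟩
      · have := Sum.inl.inj hx₁'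
        subst this
        rw [Sym2.mem_iff_exists] at hx
        obtain ⟨y, hy⟩ := hx
        exact ⟨x₁, hx₁, y, hy⟩
      · exact absurd he₁ Sum.inr_ne_inl
  · rintro ⟨x, hx, y, hxy⟩
    by_cases he : u ∈ ends e
    · refine ⟨Sum.inr e, Or.inr ⟨e, rfl⟩, Sum.inl (Sym2.Mem.other he), ?_⟩
      rw [splitEnds_of_mem he, Sym2.eq_swap]
    · have hxu : x ≠ u := fun h' => he (by rw [hxy, ← h']; exact Sym2.mem_mk_left _ _)
      have hyu : y ≠ u := fun h' => he (by rw [hxy, ← h']; exact Sym2.mem_mk_right _ _)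
      exact ⟨Sum.inl x, Or.inl ⟨x, hx, rfl⟩, Sum.inl y, splitEnds_eq_of_notMem hxy hxu hyu⟩

variable {h : V}

/-- **The class passes to the split** (`u ∈ U`). -/
theorem mem_outClass_split_of_mem {U : Set V} {ξ η : Config E} (hu : u ∈ U)
    (hη : η ∈ outClass ends U h ξ) :
    η ∈ outClass (splitEnds ends u) (splitRegion U) (Sum.inl h) ξ := by
  rw [mem_outClass] at hη ⊢
  refine ⟨fun e he => hη.1 e (fun h' => he ((mem_touches_split_iff hu).2 h')), ?_⟩
  rintro v' hv'
  rcases v' with x | e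
  · have hx : x ∈ hull ends η h := by
      rcases hv' with h1 | h1
      · exact Or.inl (conn_of_conn_split_inl h1)
      · exact Or.inr (conn_of_conn_split_inl h1)
    exact Or.inl ⟨x, hη.2 hx, rfl⟩
  · exact Or.inr ⟨e, rfl⟩

/-- **The class comes back from the split** on split-fine configurations (`u ∈ U`, no loop at
`u`, `h ≠ u`). -/
theorem mem_outClass_of_mem_split {U : Set V} {ξ η : Config E} (hu : u ∈ U)
    (hloop : ∀ e, ends e ≠ s(u, u)) (hhu : h ≠ u) (hf : SplitFine ends u h η)
    (hη : η ∈ outClass (splitEnds ends u) (splitRegion U) (Sum.inl h) ξ) :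
    η ∈ outClass ends U h ξ := by
  rw [mem_outClass] at hη ⊢
  refine ⟨fun e he => hη.1 e (fun h' => he ((mem_touches_split_iff hu).1 h')), ?_⟩
  intro x hx
  by_cases hxu : x = u
  · exact hxu ▸ hu
  · have hx' : Sum.inl x ∈ hull (splitEnds ends u) η (Sum.inl h) := by
      rcases hx with h1 | h1
      · exact Or.inl ((inl_mem_cluster_split_iff_of_splitFine hloop hhu hf hxu).2 h1)
      · exact Or.inr ((inl_mem_cluster_split_iff_of_splitFine hloop hhu
          (splitFine_blue_iff.2 hf) hxu).2 h1)
    rcases hη.2 hx' with ⟨y, hy, hxy⟩ | ⟨e, he⟩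
    · exact (Sum.inl.inj hxy) ▸ hy
    · exact absurd he Sum.inr_ne_inl

variable {l o : V}

/-- The side `Q` unpacked. -/
lemma mem_tgtU_iff' {ζ : Config E} :
    ζ ∈ tgtU ends l h {S : Set V | o ∈ S} ↔
      h ∉ hull ends ζ l ∧ o ∈ cluster ends ζ l ∧ o ∉ cluster ends (blue ζ) l := by
  simp only [tgtU, Finset.mem_filter, Finset.mem_univ, true_and, Set.mem_setOf_eq]

omit [Fintype E] [DecidableEq E] in
/-- On a split-fine configuration with `h ∉ C_R(l)`, the junction is not in `C_R(l)`. -/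
lemma u_notMem_cluster_l_of_splitFine {η : Config E} (hf : SplitFine ends u h η)
    (hhl : h ∉ cluster ends η l) (hlu : l ≠ u) : u ∉ cluster ends η l := by
  intro hu
  rw [cluster_eq_insert_ends_redEdges] at hu
  rcases hu with hu | ⟨e, he, hue⟩
  · exact hlu hu.symm
  · have hred : η e = true := he.1
    have hoth : Sym2.Mem.other hue ∈ cluster ends η l :=
      mem_cluster_of_mem_redEdges he (Sym2.other_mem hue)
    have h1 := inr_mem_cluster_split_of_splitFine hf hue hred
    rw [inr_mem_cluster_split_iff hue] at h1
    have h2 : Sym2.Mem.other hue ∈ cluster ends η h := conn_of_conn_split_inl h1.2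
    exact hhl (conn_trans hoth (conn_symm h2))

/-- **The side `Q` passes to the split** on split-fine configurations (`l ≠ u`). -/
theorem mem_tgtU_split_of_mem {η : Config E} (hf : SplitFine ends u h η) (hlu : l ≠ u)
    (hQ : η ∈ tgtU ends l h {S : Set V | o ∈ S}) :
    η ∈ tgtU (splitEnds ends u) (Sum.inl l) (Sum.inl h) {S : Set (V ⊕ E) | Sum.inl o ∈ S} := by
  rw [mem_tgtU_iff'] at hQ ⊢
  obtain ⟨hhl, hoA, hoB⟩ := hQ
  have hhA : h ∉ cluster ends η l := fun h' => hhl (Or.inl h')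
  have hhB : h ∉ cluster ends (blue η) l := fun h' => hhl (Or.inr h')
  refine ⟨?_, ?_, ?_⟩
  · rintro (h1 | h1)
    · exact hhA (conn_of_conn_split_inl h1)
    · exact hhB (conn_of_conn_split_inl h1)
  · exact conn_split_of_conn (u_notMem_cluster_l_of_splitFine hf hhA hlu) hoA
  · exact fun h1 => hoB (conn_of_conn_split_inl h1)

omit [Fintype E] [DecidableEq E] in
/-- On a split-fine configuration whose split side has `inl h ∉ C_R(inl l)`, the red cluster of
`l` is seen by the split (no loop at `u`, `l ≠ u`). -/
lemma cluster_l_subset_split_of_splitFine (hloop : ∀ e, ends e ≠ s(u, u)) (hlu : l ≠ u)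
    {η : Config E} (hf : SplitFine ends u h η)
    (hhl : Sum.inl h ∉ cluster (splitEnds ends u) η (Sum.inl l)) :
    cluster ends η l ⊆ {x | Sum.inl x ∈ cluster (splitEnds ends u) η (Sum.inl l)} := by
  intro v hv
  refine mem_of_conn_of_closed (ends := ends) (ω := η) ?_ (mem_cluster_self _ _ _) hv
  intro x hx y hxy
  obtain ⟨hne, e, he, hends⟩ := openGraph_adj.1 hxy
  have hxu : x ≠ u := fun h' => inl_u_notMem_cluster_split hloop hlu (h' ▸ hx)
  by_cases hyu : y = u
  · exfalso
    subst hyu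
    have hue : y ∈ ends e := by rw [hends]; exact Sym2.mem_mk_right _ _
    have hoth : Sym2.Mem.other hue = x := other_eq_of_ends hue (ends_swap hends) hxu
    have h1 := inr_mem_cluster_split_of_splitFine hf hue he
    rw [inr_mem_cluster_split_iff hue, hoth] at h1
    exact hhl (conn_trans hx (conn_symm h1.2))
  · exact mem_cluster_of_edge (v := Sum.inl l) hx he (splitEnds_eq_of_notMem hends hxu hyu)

/-- **The side `Q` comes back from the split** on split-fine configurations (no loop at `u`,
`l ≠ u`). -/
theorem mem_tgtU_of_mem_split (hloop : ∀ e, ends e ≠ s(u, u)) (hlu : l ≠ u) {η : Config E}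
    (hf : SplitFine ends u h η)
    (hQ : η ∈ tgtU (splitEnds ends u) (Sum.inl l) (Sum.inl h) {S : Set (V ⊕ E) | Sum.inl o ∈ S}) :
    η ∈ tgtU ends l h {S : Set V | o ∈ S} := by
  rw [mem_tgtU_iff'] at hQ ⊢
  obtain ⟨hhl, hoA, hoB⟩ := hQ
  have hhA : Sum.inl h ∉ cluster (splitEnds ends u) η (Sum.inl l) := fun h' => hhl (Or.inl h')
  have hhB : Sum.inl h ∉ cluster (splitEnds ends u) (blue η) (Sum.inl l) :=
    fun h' => hhl (Or.inr h')
  have hA := cluster_l_subset_split_of_splitFine hloop hlu hf hhA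
  have hB := cluster_l_subset_split_of_splitFine hloop hlu (splitFine_blue_iff.2 hf) hhB
  refine ⟨?_, conn_of_conn_split_inl hoA, fun h' => hoB (hB h')⟩
  rintro (h1 | h1)
  · exact hhA (hA h1)
  · exact hhB (hB h1)

end Region

end LocRows

end Summit.Ventures.PercRepro2
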